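import Summits.HodgeConjecture.HodgeConjecture.Theorems.F0P3KitOfRecord                    -- ★ K0 (p04 (g7)): `kitOfRecord`, tokens of record `trGp₀ tens₀ chS₀ hat₀ TestS₀ Unr₀ clInfChoiceU clFinChoice evpChoice cptTriv₀ Cls rep`, V6-A vocabulary
import Summits.HodgeConjecture.HodgeConjecture.Theorems.F0P3RamClsOfRecord                 -- ★ «RC» (B-p08 (g20)): `ramCls₀` — the exact ramification set of record
import Literature.NumberTheory.Automorphic.UnitaryGroupArchCharacter                       -- ★ D8-1 p822829 (F0-typ1 (g6)): `UnitaryGroup.archTr₀ L ι H T hT νinf`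
import Literature.NumberTheory.Automorphic.UnitaryGroupAdelicHaarOfLocal                   -- ★ (C-glob): `adelicProdEquiv`, `finAdelicEquiv`, `localPiEquiv`, `localInt`, `rpMeasure`; `exists_isHaarMeasure_arch_eq_map_prod_rpMeasure`
import HarnessLib

/-!
# Crux `H413` — T5 ED. 4, K8 §3: LETTER TF «TraceFactorisation» (row #3 (L7) `Factorisation`, CLASS PART) AT THE KIT OF RECORD, and its measure premise
# PH `IsProductHaar` («`dg = dg_∞ ⊗ ⊗′_v dg_v`, `vol U(H)(𝒪_v) = 1`»)

F0∕P3 «U3-mult», cell `hodgecm-mathlib`, crux H413 (`stmt-HodgeConjecture-24833`); pen F0P3-p02 (g7) (F0P3-plan (g5) 12:57:56Z ∕ 12:59:14Z re-assignment of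
`K8-LETTERS.F0P3g5.md` §3; H2 = Theorems-side statement module because the honest statement needs the Summit-side tokens of record).  DEF lane
(`--kind definition --supports stmt-HodgeConjecture-24833 --as helper`): TWO `def … : Prop` WITH BODY (`IsProductHaar`, `TraceFactorisation`), their `Iff.rfl`
unfoldings and read-backs, and the GLUE `traceFactorisation_kitOfRecord`; no instance, no notation, no `sorry`.

## §1 PH `IsProductHaar ν νinf μv` — the MEASURE PREMISE (NOT a letter: dischargeable in-house at K9)
T1's kit and ★ K0's `trGp₀` integrate against a Haar measure `ν` on `G′(𝔸) = U(H)(𝔸_{L⁺})`; the tokens of record `archTr₀ … νinf` (D8-1) and `chS₀ … μv`,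
`evpChoice … (μv v)` read an archimedean measure `νinf` on `G′_∞ = U(H)(L⁺ ⊗ ℝ)` and a family `μv` of local measures.  The factorisation of traces is
print-true exactly when these are ONE product Haar measure [Rogawski1990 §4.3 p. 44, §5.4 p. 72: «`dg = ⊗_v dg_v` with `vol(K_v) = 1` for almost all `v`»;
BorelJacquet1979 §4.1; Tate, CasselsFrohlichANT1967 XV §3.3], which the tree can SAY ON THE NOSE: `IsProductHaar ν νinf μv :=` all three are Haar measures,
`μv v (U(H)(𝒪_v)) = 1` at EVERY finite `v`, and `ν = (adelicProdEquiv⁻¹)_* (νinf ⊗ (finAdelicEquiv⁻¹)_* ∏′_v ((localPiEquiv v)⁻¹_* (μv v) ; U(H)(𝒪_v)))` — the `hνA`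
expression of ★ `UnitaryGroup.exists_isHaarMeasure_arch_eq_map_prod_rpMeasure` (★ `UnitaryGroupAdelicHaarOfLocal`), which proves that for EVERY Haar `ν` and every
normalised Haar family `μv` (★ `exists_isHaarMeasure_family_cmLocalIntegralLevel_eq_one`) such a `νinf` EXISTS.  So PH is an in-house-dischargeable premise of K9
(choose `μv` normalised, then `νinf` by that theorem), not a citation.  Stronger than the pure-tensor integral identity of the memo's §9 sketch (which it implies by
★ `UnitaryGroupPureTensorEulerProduct`), hence the letter below is WEAKER (safer) than the memo's.

## §2 TF `TraceFactorisation` — THE LETTER (row #3, class part, k = 1)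
TEXT = the class conjunct of ★ V6-B `Factorisation` (:65–:68; = ★-to-be K9α `FactorisationCls`) AT `𝔠₀ = kitOfRecord … (archTr₀ L ι H T hT νinf) ν μv F0P3RamClsOfRecord.ramCls₀`
with every kit field replaced by its token of record (★ K0 read-backs, all `rfl`), under the premise PH: for every finite `S`, class `c`, `S ∪ ∞`-test datum `fS`
(★ `TestS₀`: `f′_∞` of test grade and `Kc`-bi-invariant — «`f′_∞ = f_ι ⊗ e_{Kc}`», RULING (V31)) and unramified tensor `fT = f^S` (★ `Unr₀`):
* if `c` is UNRAMIFIED OFF `S` (`ramCls₀ (rep c) ⊆ S`, ★ «RC»: the exact non-sphericity set) and `Kc`-TRIVIAL (★ `cptTriv₀`), then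
  `tr π′_c(f′_{S,∞} ⊗ f^S) = Θ_{π′_{c,∞}}(f′_∞) · ∏_{v ∈ S} tr π′_{c,v}(f′_v) · f^{S∧}(t(π′_c))`, i.e.
  `trGp₀ ν c (tens₀ S fS fT) = chS₀ (archTr₀ νinf) μv S (clInfChoiceU [J⁺] (rep c), (clFinChoice (rep c) v)_{v∈S}) fS * hat₀ S (germ (evpChoice (rep c) · (μv ·))) fT`;
* otherwise `trGp₀ ν c (tens₀ S fS fT) = 0`.
PRINT [Flath1979 Thms. 3–4 (`π′ ≅ ⊗′ π′_v`, the character of a pure tensor is the product of the local characters); CartierCorvallis1979 §IV.1 (`tr π′_v(f_v) = f_v^∧(t_v)` for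
`π′_v` spherical, `f_v ∈ ℋ(G′_v, K_v)`, `vol K_v = 1`); Rogawski1990 §13.7 p. 206 («`f^∧(t)`»), §14.5 p. 237 («`tr π′(f′)`»); HarishChandra1954 ∕ Knapp1986 Thm. 10.2 (`π(f)` trace
class); BorelJacquet1979 §4.1].  The `= 0` branch: a place `v ∉ S` in `ramCls₀ (rep c)` carries a NON-spherical `π′_v` against a `K_v`-bi-invariant factor of `f^S`
(`π′_v(f_v) = π′_v(e_{K_v}) π′_v(f_v) π′_v(e_{K_v}) = 0`), and a class that is not `Kc`-trivial has `π′_∞ = π_ι ⊠ π_c` with `π_c ≠ 𝟙` irreducible of the compact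
`Kc`, killed by the `Kc`-bi-invariant `f′_∞` [Rogawski1990 §14.6 p. 244; RULING (V31)].
JUNK AUDIT (every junk value of the tokens is OFF the print locus): `trGp₀`'s `∑'` IS `tr π′(f′)` (trace class; ★ `F0P3SpectralSideOfRecord` §2 proves the Hilbert–Schmidt
regrouping it needs); `clInfChoiceU` branch 1 for every automorphic class (★ ARCH p823318: a coh-unitary token exists); `clFinChoice` branches 1∕2 (★ AFA p822536: an
irreducible admissible finite component exists); `evpChoice` is read by `hat₀` ONLY on the spherical factors `fT.loc v ∈ ℋ(G′_v, K_v)` where it is the genuine eigencharacter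
(★ `isSphericalWith_evpChoice_of_isSpherical`, `v ∉ ramCls₀`); `archTr₀`'s junk `0` needs «no unitary globalization ∕ `f′_∞ ∉ C_c` ∕ `νinf` not finite on compacta» — excluded
by coh-unitarity [HarishChandra1953 Thm. 9], ★ `TestS₀.continuous_arch`∕`hasCompactSupport_arch`, and PH (Haar ⇒ finite on compacta); `ramCls₀` is the EXACT
non-sphericity set (R-12), so «unramified off `S`» is print's hypothesis; `μv v (K_v) = 1` is in PH, so `evpChoice`'s `μ(K_v)⁻¹ tr` normalisation IS `tr`.  Hence TF is the
printed factorisation, neither stronger nor vacuous.  BOOKS: k = 1 (row #3 class part; PH adds nothing).  HONEST LABEL: HC_CM is proved only modulo the printed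
citations until rung 0 closes; this file asserts nothing (two predicates with bodies) and its glue is `rfl`-transport.

## §3 GLUE `traceFactorisation_kitOfRecord : IsProductHaar … → TraceFactorisation … → ‹the class conjunct of `Factorisation` at 𝔠₀›`
— token for token the body of K9α's `FactorisationCls (kitOfRecord …)` (★ K0 read-backs `kitOfRecord_trGp∕_tens∕_chS∕_coordS∕_hat∕_evp∕_ramCls∕_cptTriv`, all `rfl`), so K9's
`factorisationCls_kitOfRecord` is this term (`exact`).

References: D. Flath, PSPM 33.1 (1979) Thms. 3–4 [FlathCorvallis1979]; P. Cartier, PSPM 33.1 (1979) §IV.1 [CartierCorvallis1979]; J. Rogawski, Ann. of Math. Stud. 123 (1990)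
§4.3 p. 44, §5.4 p. 72, §13.7 p. 206, §14.5 p. 237, §14.6 p. 244 [Rogawski1990]; A. Borel, H. Jacquet, PSPM 33.1 (1979) §4.1 [BorelJacquet1979]; A. Knapp (1986) Thm. 10.2
[Knapp1986]; J. Tate in Cassels–Fröhlich (1967) XV §3.3 [CasselsFrohlichANT1967]; Harish-Chandra, TAMS 75 (1953) [HarishChandra1953].
-/

set_option autoImplicit false
-- the mandated namespace has the single-problem summit's repeated segment (`HodgeConjecture.HodgeConjecture`)
set_option linter.dupNamespace false

noncomputable section
namespace Summit.HodgeConjecture.HodgeConjecture.Cruxes.H413.F0P3LettersTraceFactorisation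

open NumberField IsDedekindDomain MeasureTheory
open Literature.NumberTheory.Rogawski1990 Literature.NumberTheory.GaloisRepresentations
open Literature.NumberTheory.Automorphic Literature.NumberTheory.Automorphic.UnitaryGroup
open Literature.NumberTheory.Automorphic.UnitaryGroup.CotangentForms
open Literature.MeasureTheory.RestrictedProduct (rpMeasure)
open scoped Matrix
open Summit.HodgeConjecture.HodgeConjecture.Cruxes.H413.F0P3InnerFormClassificationV6
open Summit.HodgeConjecture.HodgeConjecture.Cruxes.H413.F0P3ClassTokensOfRecord (Cls cl rep mult)
open Summit.HodgeConjecture.HodgeConjecture.Cruxes.H413.F0P3ClassTokenChoice (clFinChoice evpChoice)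
open Summit.HodgeConjecture.HodgeConjecture.Cruxes.H413.F0P3CompactTrivOfRecord (cptTriv₀)
open Summit.HodgeConjecture.HodgeConjecture.Cruxes.H413.F0P3UnitaryLocOfRecord (clInfChoiceU)
open Summit.HodgeConjecture.HodgeConjecture.Cruxes.H413.F0P3TestFunctionsOfRecord (Unr₀ hat₀)
open Summit.HodgeConjecture.HodgeConjecture.Cruxes.H413.F0P3SpectralSideOfRecord (trGp₀)
open Summit.HodgeConjecture.HodgeConjecture.Cruxes.H413.F0P3SemilocalTestFunctionsOfRecord (TestS₀ tens₀ chS₀)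
open Summit.HodgeConjecture.HodgeConjecture.Cruxes.H413.F0P3bArchDegOneClass (archDegOneClass)
open Summit.HodgeConjecture.HodgeConjecture.Cruxes.H413.F0P3RamClsOfRecord (ramCls₀)
open Summit.HodgeConjecture.HodgeConjecture.Cruxes.H413.F0P3KitOfRecord (kitOfRecord GHSide XiSide)

variable (L : Type) [Field L] [NumberField L] [IsCMField L] (H : Matrix (Fin 3) (Fin 3) L)

/-! ## §1 PH — the product-Haar premise -/

section PH

variable [MeasurableSpace (Gp L H).Adelic]

/-- **PH `IsProductHaar ν νinf μv` — «`dg = dg_∞ ⊗ ⊗′_v dg_v`, `vol U(H)(𝒪_v) = 1`»** [Rogawski1990 §4.3 p. 44, §5.4 p. 72; BorelJacquet1979 §4.1; Tate XV §3.3]: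
`ν` (on `U(H)(𝔸_{L⁺})`), `νinf` (on `U(H)(L⁺ ⊗ ℝ)`) and every `μv v` (on `U(H)(L⁺_v)`) are Haar measures (Borel structures on the factors = `borel`, the convention of ★ K0's
`μv` and ★ D8-1's `νinf`), `μv v (U(H)(𝒪_v)) = 1` at every finite `v` (★ `cmLocalIntegralLevel`), and `ν` IS the push-forward along ★ `adelicProdEquiv⁻¹` of
`νinf ⊗ (finAdelicEquiv⁻¹)_* ∏′_v ((localPiEquiv v)⁻¹_* μv v ; U(H)(𝒪_v))` (★ `rpMeasure`, Tate's restricted product measure) — the `hνA` expression of ★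
`UnitaryGroup.exists_isHaarMeasure_arch_eq_map_prod_rpMeasure`, which shows that such a `νinf` exists for every Haar `ν` and every normalised Haar family `μv`
(so PH is dischargeable in-house; it is a premise, not a citation). [cite: Rogawski1990, §4.3 p. 44 and §5.4 p. 72] [cite: BorelJacquet1979, §4.1]
[cite: CasselsFrohlichANT1967, Ch. XV (Tate) §3.3] -/
def IsProductHaar (ν : Measure (Gp L H).Adelic)
    (νinf : @Measure (UnitaryGroup.arch (↥(maximalRealSubfield L)) L (IsCMField.complexConj L) 3 H) (borel _))
    (μv : ∀ v : Places L, @Measure ((cmDatum L 3 H).Local v) (borel _)) : Prop :=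
  letI : MeasurableSpace (UnitaryGroup.arch (↥(maximalRealSubfield L)) L (IsCMField.complexConj L) 3 H) := borel _
  letI : ∀ v : Places L, MeasurableSpace ((cmDatum L 3 H).Local v) := fun _ => borel _
  letI : ∀ v : Places L, MeasurableSpace ↥(«local» L (IsCMField.complexConj L) 3 H v) := fun _ => borel _
  letI : ∀ v : Places L, MeasurableSpace ↥(localPi L (IsCMField.complexConj L) 3 H v) := fun _ => borel _
  letI : MeasurableSpace (finAdelic (↥(maximalRealSubfield L)) L (IsCMField.complexConj L) 3 H) := borel _
  ν.IsHaarMeasure ∧ νinf.IsHaarMeasure ∧ (∀ v : Places L, (μv v).IsHaarMeasure) ∧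
    (∀ v : Places L, μv v (cmLocalIntegralLevel L 3 H v : Set ((cmDatum L 3 H).Local v)) = 1) ∧
    ν = Measure.map (adelicProdEquiv (↥(maximalRealSubfield L)) L (IsCMField.complexConj L) 3 H).symm.toMulEquiv
      (νinf.prod (Measure.map (finAdelicEquiv (↥(maximalRealSubfield L)) L (IsCMField.complexConj L) 3 H).symm.toMulEquiv
        (rpMeasure (fun v => (localInt L (IsCMField.complexConj L) 3 H v : Set ↥(localPi L (IsCMField.complexConj L) 3 H v)))
          (fun v => Measure.map (localPiEquiv L (IsCMField.complexConj L) 3 H v).symm (μv v)) ∅)))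

/-- Unfolding PH (`Iff.rfl`). [cite: Rogawski1990, §5.4 p. 72] -/
theorem isProductHaar_iff (ν : Measure (Gp L H).Adelic)
    (νinf : @Measure (UnitaryGroup.arch (↥(maximalRealSubfield L)) L (IsCMField.complexConj L) 3 H) (borel _))
    (μv : ∀ v : Places L, @Measure ((cmDatum L 3 H).Local v) (borel _)) :
    IsProductHaar L H ν νinf μv ↔
      letI : MeasurableSpace (UnitaryGroup.arch (↥(maximalRealSubfield L)) L (IsCMField.complexConj L) 3 H) := borel _
      letI : ∀ v : Places L, MeasurableSpace ((cmDatum L 3 H).Local v) := fun _ => borel _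
      letI : ∀ v : Places L, MeasurableSpace ↥(«local» L (IsCMField.complexConj L) 3 H v) := fun _ => borel _
      letI : ∀ v : Places L, MeasurableSpace ↥(localPi L (IsCMField.complexConj L) 3 H v) := fun _ => borel _
      letI : MeasurableSpace (finAdelic (↥(maximalRealSubfield L)) L (IsCMField.complexConj L) 3 H) := borel _
      ν.IsHaarMeasure ∧ νinf.IsHaarMeasure ∧ (∀ v : Places L, (μv v).IsHaarMeasure) ∧
        (∀ v : Places L, μv v (cmLocalIntegralLevel L 3 H v : Set ((cmDatum L 3 H).Local v)) = 1) ∧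
        ν = Measure.map (adelicProdEquiv (↥(maximalRealSubfield L)) L (IsCMField.complexConj L) 3 H).symm.toMulEquiv
          (νinf.prod (Measure.map (finAdelicEquiv (↥(maximalRealSubfield L)) L (IsCMField.complexConj L) 3 H).symm.toMulEquiv
            (rpMeasure (fun v => (localInt L (IsCMField.complexConj L) 3 H v : Set ↥(localPi L (IsCMField.complexConj L) 3 H v)))
              (fun v => Measure.map (localPiEquiv L (IsCMField.complexConj L) 3 H v).symm (μv v)) ∅))) :=
  Iff.rfl

variable {L H}

/-- Read-back: under PH, `ν` is a Haar measure on `U(H)(𝔸_{L⁺})`. [cite: Rogawski1990, §4.3 p. 44] -/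
theorem IsProductHaar.isHaarMeasure {ν : Measure (Gp L H).Adelic}
    {νinf : @Measure (UnitaryGroup.arch (↥(maximalRealSubfield L)) L (IsCMField.complexConj L) 3 H) (borel _)}
    {μv : ∀ v : Places L, @Measure ((cmDatum L 3 H).Local v) (borel _)} (h : IsProductHaar L H ν νinf μv) : ν.IsHaarMeasure :=
  h.1

/-- Read-back: under PH, `νinf` is a Haar measure on `U(H)(L⁺ ⊗ ℝ)` (for the Borel structure). [cite: Rogawski1990, §4.3 p. 44] -/
theorem IsProductHaar.isHaarMeasure_arch {ν : Measure (Gp L H).Adelic}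
    {νinf : @Measure (UnitaryGroup.arch (↥(maximalRealSubfield L)) L (IsCMField.complexConj L) 3 H) (borel _)}
    {μv : ∀ v : Places L, @Measure ((cmDatum L 3 H).Local v) (borel _)} (h : IsProductHaar L H ν νinf μv) :
    letI : MeasurableSpace (UnitaryGroup.arch (↥(maximalRealSubfield L)) L (IsCMField.complexConj L) 3 H) := borel _
    νinf.IsHaarMeasure :=
  h.2.1

/-- Read-back: under PH, every `μv v` is a Haar measure on `U(H)(L⁺_v)` (for the Borel structure) — pin (iii) of `IsPinned`. [cite: Rogawski1990, §5.4 p. 72] -/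
theorem IsProductHaar.isHaarMeasure_local {ν : Measure (Gp L H).Adelic}
    {νinf : @Measure (UnitaryGroup.arch (↥(maximalRealSubfield L)) L (IsCMField.complexConj L) 3 H) (borel _)}
    {μv : ∀ v : Places L, @Measure ((cmDatum L 3 H).Local v) (borel _)} (h : IsProductHaar L H ν νinf μv) (v : Places L) :
    letI : MeasurableSpace ((cmDatum L 3 H).Local v) := borel _
    (μv v).IsHaarMeasure :=
  h.2.2.1 v

/-- Read-back: under PH, `μv v (U(H)(𝒪_v)) = 1` at every finite `v`. [cite: Rogawski1990, §5.4 p. 72] -/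
theorem IsProductHaar.apply_cmLocalIntegralLevel {ν : Measure (Gp L H).Adelic}
    {νinf : @Measure (UnitaryGroup.arch (↥(maximalRealSubfield L)) L (IsCMField.complexConj L) 3 H) (borel _)}
    {μv : ∀ v : Places L, @Measure ((cmDatum L 3 H).Local v) (borel _)} (h : IsProductHaar L H ν νinf μv) (v : Places L) :
    μv v (cmLocalIntegralLevel L 3 H v : Set ((cmDatum L 3 H).Local v)) = 1 :=
  h.2.2.2.1 v

end PH

/-! ## §2 TF — the letter «TraceFactorisation» (row #3, class part) at the tokens of record -/

section TF

variable (ι : L →+* ℂ) (T : GL (Fin 3) ℂ)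
  (hT : (T : Matrix (Fin 3) (Fin 3) ℂ)ᴴ * H.map ι * (T : Matrix (Fin 3) (Fin 3) ℂ) = Literature.Geometry.ComplexHyperbolic.BallModel.J)
  (μ : Measure (Gp L H).automorphicQuotient) [(Gp L H).IsAutomorphicMeasure μ]
  [MeasurableSpace (Gp L H).Adelic] [BorelSpace (Gp L H).Adelic]

/-- **TF «TraceFactorisation» — THE TRACE OF A CLASS ON A PURE TENSOR FACTORISES (row #3 (L7), class part, at the kit of record).**  Under PH, for every finite set
of places `S`, every class `c` of discrete `π′` of `U(H)` (★ `Cls`), every `S ∪ ∞`-test datum `fS = (f′_∞, (f′_v)_{v∈S})` (★ `TestS₀`: `f′_∞ ∈ C_c(G′_∞)` of test grade and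
`Kc`-bi-invariant) and every unramified tensor `fT = f^S` (★ `Unr₀`): if `π′` is UNRAMIFIED OFF `S` (`ramCls₀ (rep c) ⊆ S`, ★ «RC») and `Kc`-TRIVIAL (★ `cptTriv₀`), then
`tr π′(f′_∞ ⊗ ⊗_{v∈S} f′_v ⊗ f^S) = Θ_{π′_∞}(f′_∞) · ∏_{v∈S} tr π′_v(f′_v) · f^{S∧}(t(π′))` — in the tokens of record `trGp₀ ν c (tens₀ S fS fT) = chS₀ (archTr₀ νinf) μv S
(clInfChoiceU [J⁺] (rep c), (clFinChoice (rep c) v)_v) fS * hat₀ S (germ (t(π′))) fT` with `t(π′)_v = evpChoice (rep c) v (μv v)` — and OTHERWISE `tr π′(f′_{S,∞} ⊗ f^S) = 0`.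
Print: Flath's tensor-product theorem and the product formula for characters of pure tensors; Cartier's `tr π_v(f_v) = f_v^∧(t_v)` for spherical `π_v` (`vol K_v = 1`); the
vanishing at a non-spherical place against a `K_v`-bi-invariant factor, and at a non-`Kc`-trivial class against the `Kc`-bi-invariant `f′_∞` (junk audit and books: module
docstring §2). [cite: FlathCorvallis1979, Thm. 3 and Thm. 4] [cite: CartierCorvallis1979, §IV.1] [cite: Rogawski1990, §13.7 p. 206; §14.5 p. 237; §14.6 p. 244]
[cite: BorelJacquet1979, §4.1] [cite: Knapp1986, Thm. 10.2] -/
def TraceFactorisation (ν : Measure (Gp L H).Adelic) [IsFiniteMeasureOnCompacts ν]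
    (νinf : @Measure (UnitaryGroup.arch (↥(maximalRealSubfield L)) L (IsCMField.complexConj L) 3 H) (borel _))
    (μv : ∀ v : Places L, @Measure ((cmDatum L 3 H).Local v) (borel _)) : Prop :=
  IsProductHaar L H ν νinf μv →
    ∀ (S : Finset (Places L)) (c : Cls (Gp L H) μ) (fS : TestS₀ L H ι T hT S) (fT : Unr₀ L H S),
      (ramCls₀ (rep (Gp L H) μ c) ⊆ ↑S ∧ cptTriv₀ L ι H T hT μ c →
        trGp₀ (Gp L H) μ ν c (tens₀ S fS fT) =
          chS₀ (UnitaryGroup.archTr₀ L ι H T hT νinf) μv S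
              (clInfChoiceU L H ι T hT μ (archDegOneClass 1 (Or.inl rfl)) (rep (Gp L H) μ c), fun v : ↥S => clFinChoice (rep (Gp L H) μ c) v.1) fS *
            hat₀ L H S (germ L H S fun v => evpChoice (rep (Gp L H) μ c) v (μv v)) fT) ∧
      (¬ (ramCls₀ (rep (Gp L H) μ c) ⊆ ↑S ∧ cptTriv₀ L ι H T hT μ c) → trGp₀ (Gp L H) μ ν c (tens₀ S fS fT) = 0)

/-- Unfolding TF (`Iff.rfl`). [cite: FlathCorvallis1979, Thm. 3] [cite: Rogawski1990, §14.5 p. 237] -/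
theorem traceFactorisation_iff (ν : Measure (Gp L H).Adelic) [IsFiniteMeasureOnCompacts ν]
    (νinf : @Measure (UnitaryGroup.arch (↥(maximalRealSubfield L)) L (IsCMField.complexConj L) 3 H) (borel _))
    (μv : ∀ v : Places L, @Measure ((cmDatum L 3 H).Local v) (borel _)) :
    TraceFactorisation L H ι T hT μ ν νinf μv ↔
      (IsProductHaar L H ν νinf μv →
        ∀ (S : Finset (Places L)) (c : Cls (Gp L H) μ) (fS : TestS₀ L H ι T hT S) (fT : Unr₀ L H S),
          (ramCls₀ (rep (Gp L H) μ c) ⊆ ↑S ∧ cptTriv₀ L ι H T hT μ c →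
            trGp₀ (Gp L H) μ ν c (tens₀ S fS fT) =
              chS₀ (UnitaryGroup.archTr₀ L ι H T hT νinf) μv S
                  (clInfChoiceU L H ι T hT μ (archDegOneClass 1 (Or.inl rfl)) (rep (Gp L H) μ c), fun v : ↥S => clFinChoice (rep (Gp L H) μ c) v.1) fS *
                hat₀ L H S (germ L H S fun v => evpChoice (rep (Gp L H) μ c) v (μv v)) fT) ∧
          (¬ (ramCls₀ (rep (Gp L H) μ c) ⊆ ↑S ∧ cptTriv₀ L ι H T hT μ c) → trGp₀ (Gp L H) μ ν c (tens₀ S fS fT) = 0)) :=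
  Iff.rfl

/-! ## §3 GLUE — TF at the kit of record is the class conjunct of law `Factorisation` (K9α's `FactorisationCls`), token for token -/

/-- **GLUE `traceFactorisation_kitOfRecord`**: under PH, TF IS the class conjunct of law (L7) `Factorisation` (★ V6-B :65–:68 = K9α `FactorisationCls`) evaluated at
`𝔠₀ = kitOfRecord 𝔰 gh ξd μω c jInf dsInf (archTr₀ L ι H T hT νinf) ν μv ramCls₀` — every kit field is its token of record by `rfl` (★ K0 read-backs), so the body below is
`FactorisationCls 𝔠₀` unfolded and K9's `factorisationCls_kitOfRecord hPH hTF := traceFactorisation_kitOfRecord … hPH hTF`. [cite: FlathCorvallis1979, Thm. 3 and Thm. 4]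
[cite: Rogawski1990, §14.5 p. 237] -/
theorem traceFactorisation_kitOfRecord (𝔰 : Sockets L H μ) (gh : GHSide L H ι T hT 𝔰.PacketG 𝔰.PacketH) (ξd : XiSide L H 𝔰.PacketG 𝔰.PacketH)
    (μω : HeckeCharacter L) (c : ℚ) (jInf dsInf : ℤ → ℤ → ℤ → Cinf)
    (ν : Measure (Gp L H).Adelic) [IsFiniteMeasureOnCompacts ν]
    (νinf : @Measure (UnitaryGroup.arch (↥(maximalRealSubfield L)) L (IsCMField.complexConj L) 3 H) (borel _))
    (μv : ∀ v : Places L, @Measure ((cmDatum L 3 H).Local v) (borel _))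
    (hPH : IsProductHaar L H ν νinf μv) (hTF : TraceFactorisation L H ι T hT μ ν νinf μv) :
    let 𝔠₀ := kitOfRecord L H ι T hT μ 𝔰 gh ξd μω c jInf dsInf (UnitaryGroup.archTr₀ L ι H T hT νinf) ν μv (ramCls₀ (L := L) (H := H) (μ := μ))
    ∀ (S : Finset (Places L)) (x : 𝔠₀.Cls) (fS : 𝔠₀.TestS S) (fT : 𝔠₀.Unr S),
      (𝔠₀.Adm S x → 𝔠₀.trGp x (𝔠₀.tens S fS fT) = 𝔠₀.chS S (𝔠₀.coordS S x) fS * 𝔠₀.hat S (germ L H S (𝔠₀.evp x)) fT) ∧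
      (¬ 𝔠₀.Adm S x → 𝔠₀.trGp x (𝔠₀.tens S fS fT) = 0) :=
  fun S x fS fT => hTF hPH S x fS fT

end TF

end Summit.HodgeConjecture.HodgeConjecture.Cruxes.H413.F0P3LettersTraceFactorisation
end
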